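import Literature.Analysis.FunctionSpaces.TorusSmallnessInterpolation
import Literature.MathematicalPhysics.KineticTheory.HardSphereEuler
import HarnessLib

/-!
# Stub 4a of the birth skeleton (rev c3) of crux `DiluteSelfConsistency`: smallness interpolation

Summits-side wrapper carrying the registered stub name `stub_smallnessInterpolation` of the line
`birth` (rev c3) of crux stmt-AtomisticToContinuum-3091 (`DiluteSelfConsistency`): layer 4a of
Kato's continuous-dependence theorem for the hard-sphere Euler family — a smooth real function on
the flat three-torus `T3 = UnitAddTorus (Fin 3)` that is SMALL in `L²` and BOUNDED in `H³` is
small in `C¹`. The substance is the Literature support theorem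
`Literature.Analysis.FunctionSpaces.Torus.smallness_interpolation_three`
(`Literature/Analysis/FunctionSpaces/TorusSmallnessInterpolation.lean`); this file only restates
it with the tree abbreviation `T3`.
-/

noncomputable section

namespace Summit.AtomisticToContinuum.HydrodynamicLimit.Theorems

open Literature.MathematicalPhysics.KineticTheory Literature.Analysis.FunctionSpaces MeasureTheory

/-- **Stub 4a (smallness interpolation on `𝕋³`).** For every `H³`-size `E` and every `ε > 0`
there is `δ > 0` such that every smooth real function on `𝕋³` with `∫ f² ≤ δ` and all `L²`
norms (squared) of its nested partial derivatives of orders `1, 2, 3` at most `E` satisfies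
`|f| ≤ ε` and `|∂ᵢ f| ≤ ε` pointwise (interpolation `‖∂ᵢf‖₂² ≤ ‖f‖₂ ‖∂ᵢ∂ᵢf‖₂`,
`‖∂ᵢ∂ⱼf‖₂² ≤ ‖∂ⱼf‖₂ ‖∂ᵢ∂ᵢ∂ⱼf‖₂` by parts; `H²(𝕋³) ⊂ L^∞`; for the zero-mean derivative `∂ᵢ f`,
Morrey with `q = 4` and Ladyzhenskaya's inequality for the zero-mean second derivatives) — the
Literature theorem `Torus.smallness_interpolation_three`. [folklore] -/
theorem stub_smallnessInterpolation :
    ∀ E ε : ℝ, 0 < ε → ∃ δ : ℝ, 0 < δ ∧ ∀ f : T3 → ℝ, Torus.IsSmooth f →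
      (∫ x, f x ^ 2) ≤ δ →
      (∀ i : Fin 3, (∫ x, Torus.partialDeriv i f x ^ 2) ≤ E) →
      (∀ i j : Fin 3, (∫ x, Torus.partialDeriv i (Torus.partialDeriv j f) x ^ 2) ≤ E) →
      (∀ i j l : Fin 3,
        (∫ x, Torus.partialDeriv i (Torus.partialDeriv j (Torus.partialDeriv l f)) x ^ 2) ≤ E) →
      ∀ x, |f x| ≤ ε ∧ ∀ i : Fin 3, |Torus.partialDeriv i f x| ≤ ε :=
  Torus.smallness_interpolation_three

end Summit.AtomisticToContinuum.HydrodynamicLimit.Theorems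

end
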